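import Summits.ABC.IUTFork.Repair.RHCellWeightsCreditScreen
import Summits.ABC.IUTFork.Repair.RHSigmaCellCredit
import HarnessLib

/-!
# R-H ROUND 3, SCREEN RULE S1 AT THE DATUM (NECESSITY): a candidate whose credit above the slice is `O(j)` (resp. `θ·j²`) can meet the weighted
# [MU-C] `OffSigmaTolerance (1−μ₀) A T (charged mass)` only for `μ₀·T.gap ≤ ((S(J) + a·T(l⋇) + b·l⋇)/S(l⋇))·T.gap + A` (resp. `(S(J) + θ(S(l⋇)−S(J)))/S(l⋇)`)

abc-iut cell, rung LADDER-ABC:A2.RESCUE.H; R-H seat abc-iut-rh2-w-1 (GEN 2; Q1′ WEIGHTS typer, kernel side); companion of `Repair/RHCellWeightsCreditScreen.lean`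
(place / bed kept-mass bounds for a credit profile `ω ≤ 1`). PROOF-ONLY (0 definitions, 0 `Prop` facts). rh-lead g2's `plan/rescue/R-H/ROUND3/START-HERE.md` v1.1
SCREEN RULE S1 (a): «credit `O(1)` or `O(j)` in `j` ⟹ pre-screened OUT as rescue (best reachable `Λ ≈ 1/(1.5 f)`)»; (b): «credit `~ θ·j²` ⟹ exponent
`≈ 1/(share of j²-weight kept)`». This file states the NECESSITY direction at a genuine Θ-volume datum `T` (c312-7 sharp bed over `T.K` at `pilotDataOfK T.D T.K`,
CHOSEN realising ideles; `M = T.gap`, p478601) in the currency the EXP programme's endpoints consume — abc-iut-rh2-xi-1's `RH.OffSigma.OffSigmaTolerance` (p469145)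
applied to abc-iut-rh2-q2-eq's CHARGED mass `RH.SigmaLicence.weightedTrivialMass P ω = PN Σᶠ (1−ω)·cost` (p480491; kept mass `weightedTrivialMass P (1−ω)
= PN Σᶠ ω·cost`, `weightedTrivialMass_compl_eq` / `weightedTrivialMass_eq_totalTrivialMass_sub`, p484504), all BY NAME:
* §1 AT THE BED (any DH pilot datum, realising ideles), UNIFORM slice `J ≤ l⋇` and law above it: `O(j)` credit ⟹ kept mass
  `weightedTrivialMass P (1−ω) ≤ ((S(J) + a·T(l⋇) + b·l⋇)/S(l⋇))·M` (`weightedTrivialMass_compl_settingPrVolSharp_le_frac_of_linearCredit`; companion's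
  `keptMass_settingPrVolSharp_le_frac_mul_totalTrivialMass` in q2-eq's name); `θ·j²` credit ⟹ `≤ ((S(J) + θ·(S(l⋇) − S(J)))/S(l⋇))·M`
  (`weightedTrivialMass_compl_settingPrVolSharp_le_frac_of_quadraticCredit`);
* §2 AT THE DATUM: **`OffSigmaTolerance (1−μ₀) A T (weightedTrivialMass … ω)` ⟹ `μ₀·T.gap ≤ ((S(J) + a·T(l⋇) + b·l⋇)/S(l⋇))·T.gap + A`**
  (`mu_mul_gap_le_of_offSigmaTolerance_weightedTrivialMass_linearCredit_chosen`) — with `A = Tol(P,l)`, `a = J`, `b = 0` (harmonic, B24) and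
  `RHCellWeightsCreditScreen.harmonicKeptFrac_eq`: **`μ₀ ≤ S(J)/S(l⋇) + 3J(l⋇+1)/((l⋇−1)(2l⋇+5)) + Tol/T.gap → f³ + (3/2)f`** on the content locus
  (`Tol/T.gap → 0`) — S1 (a)'s «best reachable exponent `≈ 1/(1.5 f)`» as a kernel NECESSITY for every `O(j)` credit; and the `θ·j²` twin
  **`μ₀·T.gap ≤ ((S(J) + θ(S(l⋇) − S(J)))/S(l⋇))·T.gap + A`** (`mu_mul_gap_le_of_offSigmaTolerance_weightedTrivialMass_quadraticCredit_chosen`) — S1 (b).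
HONEST FRAMING: arithmetic about OUR typed weights at the genuine bed; `ω` (a candidate's claimed credit) and the weighted [MU-C] are HYPOTHESIS SHAPES,
never asserted for any object; nothing here asserts that abc is proved or refuted, or that [IUTchIII] Cor. 3.12 holds or fails at any datum, or takes a side
on any author; typed ≠ proved; computed ≠ proved. [claim: Mochizuki2012, status: disputed] for every IUT locution. [cite: Mochizuki2012, IUTchIII Cor. 3.12
p. 173–174, Prop. 3.9 (i)–(iii) p. 116–117; IUTchIV Thm. 1.10 Step (v) p. 27–29, Steps (viii)–(x) p. 30–32] [cite: DupuyHilado2025, §3.3, Thm. 3.10.1]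
-/

noncomputable section

open Set Function NumberField IsDedekindDomain

namespace Summit.ABC.IUTFork.Repair.RH.CellWeights

open Summit.ABC.IUTFork.Thm311 Summit.ABC.IUTFork.Thm311.Real Summit.ABC.IUTFork.Cor312 Summit.ABC.IUTFork.Cor312.Setting
  Summit.ABC.IUTFork.Cor312Vol Summit.ABC.IUTFork.Cor312Prov Literature.IUT.LogThetaLattice Literature.IUT.LogVolume
  Literature.IUT.HodgeTheaters Literature.IUT.LogVolume.ThetaData Literature.NumberTheory.DiophantineGeometry.GenEll
  Summit.ABC.IUTFork.Repair.RH.SigmaLicence Summit.ABC.IUTFork.Repair.RH.SigmaStrataEq Summit.ABC.IUTFork.Repair.RH.SigmaMass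
  Summit.ABC.IUTFork.Repair.RH.OffSigma Summit.ABC.IUTFork.Conditional

/-! ## §1. At the bed: the kept mass in abc-iut-rh2-q2-eq's name, uniform `O(j)` / `θ·j²` laws -/

section Bed

variable {F : Type} [Field F] [NumberField F] (X : PilotData F) {logv : PadicLogs F} (hlog : LogvAnalytic logv)
  (M : Type) [Field M] [NumberField M]
  (archPk : ∀ (j : (thetaIndex X).Label) (vQ : (thetaIndex X).VQ), Set ((logShellsDH X logv).Packet j vQ))
  (archSub : ∀ (j : (thetaIndex X).Label) (v : (thetaIndex X).V),
    Set ((logShellsDH X logv).Packet j ((thetaIndex X).over v)))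
  (Ψ : ℤ → ∀ v : (thetaIndex X).V, v ∈ (thetaIndex X).Vbad → Set ((logShellsDH X logv).StarPacket v))
  (act : ℤ → ∀ v : (thetaIndex X).V, v ∈ (thetaIndex X).Vbad →
    (logShellsDH X logv).StarPacket v → Module.End ℚ ((logShellsDH X logv).StarPacket v))
  (Mmod : ℤ → ∀ j : (thetaIndex X).LabelStar, Set ((logShellsDH X logv).GlobalPacket j.1))
  (region : ℤ → ∀ j : (thetaIndex X).LabelStar, FinDivisor M → ∀ vQ : (thetaIndex X).VQ,
    Set ((logShellsDH X logv).Packet j.1 vQ))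
  (n : ℤ) {HT : Type} {LogLink : HT → HT → Type} {IsFull : ∀ {s t : HT}, LogLink s t → Prop}
  (lat : LGPGaussianLogThetaLattice LogLink IsFull)
  {Frd : Type} {IsoF : Frd → Frd → Type} {Ob : Frd → Type} {realify : Frd → Frd} {Strip : Type}
  {IsoS : Strip → Strip → Type} {Mv : ∀ v : (thetaIndex X).V, v ∈ (thetaIndex X).Vbad → Type}
  [∀ v h, Monoid (Mv v h)]
  (sig : GlobalLGPFrobenioidSignature (thetaIndex X).lstar (thetaIndex X).V (· ∈ (thetaIndex X).Vbad)
    Frd IsoF Ob realify Strip IsoS Mv)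
  (split : SplittingMonoids Mv) {ObΔ : Type} {N : ∀ v : (thetaIndex X).V, v ∈ (thetaIndex X).Vbad → Type}
  [∀ v h, Monoid (N v h)] (qData : QPilotData ObΔ N)
  (tq : ∀ (pp : Nat.Primes) (x : (thetaIndex X).Fibre (.inr pp)), haveI : Fact (pp : ℕ).Prime := ⟨pp.2⟩; kOf X pp.1 x)
  (t : ∀ (pp : Nat.Primes) (_ : Fin X.lstar) (x : (thetaIndex X).Fibre (.inr pp)),
    haveI : Fact (pp : ℕ).Prime := ⟨pp.2⟩; kOf X pp.1 x)
  (htq0 : ∀ pp x, tq pp x ≠ 0)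
  (htq1 : ∀ (pp : Nat.Primes) (x : (thetaIndex X).Fibre (.inr pp)),
    haveI : Fact (pp : ℕ).Prime := ⟨pp.2⟩; placeOf X pp.1 x ∉ X.S → ‖tq pp x‖ = 1)
  (ht0 : ∀ pp i x, t pp i x ≠ 0)
  (ht : ∀ (pp : Nat.Primes) (i : Fin X.lstar) (x : (thetaIndex X).Fibre (.inr pp)),
    haveI : Fact (pp : ℕ).Prime := ⟨pp.2⟩
    Real.log ‖t pp i x‖ = -(X.thetaPilot i (placeOf X pp.1 x)) * logNorm F (placeOf X pp.1 x) / localDegree F (placeOf X pp.1 x))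
  (htq : ∀ (pp : Nat.Primes) (x : (thetaIndex X).Fibre (.inr pp)),
    haveI : Fact (pp : ℕ).Prime := ⟨pp.2⟩
    Real.log ‖tq pp x‖ = -(X.qPilot (placeOf X pp.1 x)) * logNorm F (placeOf X pp.1 x) / localDegree F (placeOf X pp.1 x))

include ht0 ht htq in
/-- **(S1-a) the KEPT mass in abc-iut-rh2-q2-eq's name**: for `ω ≤ 1` with a UNIFORM `O(j)` credit law above the slice `J ≤ l⋇`
(`ω(i,v_ℚ)·((i+1)²−1) ≤ a·(i+1) + b`, `a, b ≥ 0`), `weightedTrivialMass P (1−ω) ≤ ((S(J) + a·T(l⋇) + b·l⋇)/S(l⋇))·M` at the bed (realising ideles) —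
the companion's `keptMass_settingPrVolSharp_le_frac_mul_totalTrivialMass` read through q2-eq's `weightedTrivialMass_compl_eq`. [claim: Mochizuki2012, status: disputed] -/
theorem weightedTrivialMass_compl_settingPrVolSharp_le_frac_of_linearCredit
    (ω : Fin (thetaIndex X).lstar × (thetaIndex X).VQ → ℝ) (hω1 : ∀ c, ω c ≤ 1)
    {J : ℕ} (hJ : J ≤ X.lstar) {a b : ℝ} (ha : 0 ≤ a) (hb : 0 ≤ b)
    (hlin : ∀ (i : Fin (thetaIndex X).lstar) (vQ : (thetaIndex X).VQ), J < (i : ℕ) + 1 →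
      ω (i, vQ) * ((((i : ℕ) : ℝ) + 1) ^ 2 - 1) ≤ a * (((i : ℕ) : ℝ) + 1) + b) :
    weightedTrivialMass (settingPrVolSharp X hlog M archPk archSub Ψ act Mmod region n lat sig split qData tq t htq0 htq1) (fun c => 1 - ω c) ≤
      ((J : ℝ) * (J - 1) * (2 * J + 5) / 6 + a * ((X.lstar : ℝ) * (X.lstar + 1) / 2) + b * X.lstar) /
          ((X.lstar : ℝ) * (X.lstar - 1) * (2 * X.lstar + 5) / 6) *
        totalTrivialMass (settingPrVolSharp X hlog M archPk archSub Ψ act Mmod region n lat sig split qData tq t htq0 htq1) := by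
  rw [weightedTrivialMass_compl_eq]
  exact keptMass_settingPrVolSharp_le_frac_mul_totalTrivialMass X hlog M archPk archSub Ψ act Mmod region n lat sig split qData tq t htq0 htq1
    ht0 ht htq ω hω1 hJ ha hb hlin

include ht0 ht htq in
/-- **(S1-b) the KEPT mass under a UNIFORM `θ·j²` credit law**: `ω ≤ 1`, `ω(i,v_ℚ)·((i+1)²−1) ≤ θ·((i+1)²−1)` above the slice `J ≤ l⋇` at every packet ⟹
`weightedTrivialMass P (1−ω) ≤ ((S(J) + θ·(S(l⋇) − S(J)))/S(l⋇))·M` (companion's `keptMass_settingPrVolSharp_le_of_quadraticCredit` with constants, and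
`M = (S(l⋇)/l⋇)·Σᶠ h`, p482743). [claim: Mochizuki2012, status: disputed] -/
theorem weightedTrivialMass_compl_settingPrVolSharp_le_frac_of_quadraticCredit
    (ω : Fin (thetaIndex X).lstar × (thetaIndex X).VQ → ℝ) (hω1 : ∀ c, ω c ≤ 1)
    {J : ℕ} (hJ : J ≤ X.lstar) {θ : ℝ}
    (hquad : ∀ (i : Fin (thetaIndex X).lstar) (vQ : (thetaIndex X).VQ), J < (i : ℕ) + 1 →
      ω (i, vQ) * ((((i : ℕ) : ℝ) + 1) ^ 2 - 1) ≤ θ * ((((i : ℕ) : ℝ) + 1) ^ 2 - 1)) :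
    weightedTrivialMass (settingPrVolSharp X hlog M archPk archSub Ψ act Mmod region n lat sig split qData tq t htq0 htq1) (fun c => 1 - ω c) ≤
      ((J : ℝ) * (J - 1) * (2 * J + 5) / 6 +
            θ * ((X.lstar : ℝ) * (X.lstar - 1) * (2 * X.lstar + 5) / 6 - (J : ℝ) * (J - 1) * (2 * J + 5) / 6)) /
          ((X.lstar : ℝ) * (X.lstar - 1) * (2 * X.lstar + 5) / 6) *
        totalTrivialMass (settingPrVolSharp X hlog M archPk archSub Ψ act Mmod region n lat sig split qData tq t htq0 htq1) := by
  rw [weightedTrivialMass_compl_eq]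
  have h := keptMass_settingPrVolSharp_le_of_quadraticCredit X hlog M archPk archSub Ψ act Mmod region n lat sig split qData tq t htq0 htq1 ht0 ht htq
    ω hω1 (J := fun _ => J) (fun _ => hJ) (θ := fun _ => θ) (fun i vQ hi => hquad i vQ hi)
  rw [totalTrivialMass_settingPrVolSharp_eq_sqSubOneSum_mul_finsum_placeWeight X hlog M archPk archSub Ψ act Mmod region n lat sig split qData tq t
    htq0 htq1 ht0 ht htq]
  rw [← mul_finsum] at h
  have h2 : (2 : ℝ) ≤ X.lstar := by exact_mod_cast X.two_le_lstar
  have hl0 : (X.lstar : ℝ) ≠ 0 := by positivity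
  have hl1 : (X.lstar : ℝ) - 1 ≠ 0 := (show (0 : ℝ) < X.lstar - 1 by linarith).ne'
  have hl5 : 2 * (X.lstar : ℝ) + 5 ≠ 0 := by positivity
  refine h.trans (le_of_eq ?_)
  field_simp

end Bed

/-! ## §2. At a genuine Θ-volume datum with the chosen ideles: the weighted [MU-C] FORCES `μ₀ ≤ kept fraction + A/T.gap` -/

section Datum

/-- **S1 (a) NECESSITY AT THE DATUM.** For a candidate's weight `ω ≤ 1` with a uniform `O(j)` credit law above the slice `J ≤ l⋇` (`a, b ≥ 0`), the weighted
[MU-C] `OffSigmaTolerance (1−μ₀) A T (weightedTrivialMass … ω)` («charged mass `≤ (1−μ₀)·T.gap + A`», the binder q2-eq's partial-credit / weighted doors feed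
to the EXP endpoints) FORCES **`μ₀·T.gap ≤ ((S(J) + a·T(l⋇) + b·l⋇)/S(l⋇))·T.gap + A`**. With `a = J`, `b = 0` (harmonic, B24), `A = Tol(P,l)` and the
companion's `harmonicKeptFrac_eq`: `μ₀ ≤ S(J)/S(l⋇) + 3J(l⋇+1)/((l⋇−1)(2l⋇+5)) + Tol/T.gap → f³ + (3/2)·f` on the content locus — «an `O(j)` credit is
pre-screened OUT as rescue: exponent `≳ 1/(1.5 f)`», for EVERY such candidate, as typed. [claim: Mochizuki2012, status: disputed] -/
theorem mu_mul_gap_le_of_offSigmaTolerance_weightedTrivialMass_linearCredit_chosen {P : NFPoint} {l : ℕ} (T : Cor22.ThetaVolumeDatumAt P l) :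
    letI := T.instFieldF; letI := T.instNumberFieldF; letI := T.instAlgebraF; letI := T.instFieldK; letI := T.instNumberFieldK; letI := T.instAlgebraK;
        letI := T.instFieldFbar; letI := T.instAlgebraFbar; letI := T.instAlgebraKFbar; letI := T.instIsElliptic;
    ∀ (M : Type) [Field M] [NumberField M]
      (archPk : ∀ (j : (thetaIndex (pilotDataOfK T.D T.K)).Label) (vQ : (thetaIndex (pilotDataOfK T.D T.K)).VQ), Set ((logShellsDH (pilotDataOfK T.D T.K) (analyticLogv T.K)).Packet j vQ))
      (archSub : ∀ (j : (thetaIndex (pilotDataOfK T.D T.K)).Label) (v : (thetaIndex (pilotDataOfK T.D T.K)).V),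
        Set ((logShellsDH (pilotDataOfK T.D T.K) (analyticLogv T.K)).Packet j ((thetaIndex (pilotDataOfK T.D T.K)).over v)))
      (Ψ : ℤ → ∀ v : (thetaIndex (pilotDataOfK T.D T.K)).V, v ∈ (thetaIndex (pilotDataOfK T.D T.K)).Vbad → Set ((logShellsDH (pilotDataOfK T.D T.K) (analyticLogv T.K)).StarPacket v))
      (act : ℤ → ∀ v : (thetaIndex (pilotDataOfK T.D T.K)).V, v ∈ (thetaIndex (pilotDataOfK T.D T.K)).Vbad →
        (logShellsDH (pilotDataOfK T.D T.K) (analyticLogv T.K)).StarPacket v → Module.End ℚ ((logShellsDH (pilotDataOfK T.D T.K) (analyticLogv T.K)).StarPacket v))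
      (Mmod : ℤ → ∀ j : (thetaIndex (pilotDataOfK T.D T.K)).LabelStar, Set ((logShellsDH (pilotDataOfK T.D T.K) (analyticLogv T.K)).GlobalPacket j.1))
      (region : ℤ → ∀ j : (thetaIndex (pilotDataOfK T.D T.K)).LabelStar, FinDivisor M →
        ∀ vQ : (thetaIndex (pilotDataOfK T.D T.K)).VQ, Set ((logShellsDH (pilotDataOfK T.D T.K) (analyticLogv T.K)).Packet j.1 vQ))
      (n : ℤ) {HT : Type} {LogLink : HT → HT → Type} {IsFull : ∀ {s t : HT}, LogLink s t → Prop} (lat : LGPGaussianLogThetaLattice LogLink IsFull)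
      {Frd : Type} {IsoF : Frd → Frd → Type} {Ob : Frd → Type} {realify : Frd → Frd} {Strip : Type} {IsoS : Strip → Strip → Type}
      {Mv : ∀ v : (thetaIndex (pilotDataOfK T.D T.K)).V, v ∈ (thetaIndex (pilotDataOfK T.D T.K)).Vbad → Type} [∀ v h, Monoid (Mv v h)]
      (sig : GlobalLGPFrobenioidSignature (thetaIndex (pilotDataOfK T.D T.K)).lstar (thetaIndex (pilotDataOfK T.D T.K)).V
        (· ∈ (thetaIndex (pilotDataOfK T.D T.K)).Vbad) Frd IsoF Ob realify Strip IsoS Mv)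
      (split : SplittingMonoids Mv) {ObΔ : Type} {N : ∀ v : (thetaIndex (pilotDataOfK T.D T.K)).V, v ∈ (thetaIndex (pilotDataOfK T.D T.K)).Vbad → Type}
      [∀ v h, Monoid (N v h)] (qData : QPilotData ObΔ N)
      (ω : Fin (thetaIndex (pilotDataOfK T.D T.K)).lstar × (thetaIndex (pilotDataOfK T.D T.K)).VQ → ℝ) (_ : ∀ c, ω c ≤ 1)
      (J : ℕ) (_ : J ≤ (pilotDataOfK T.D T.K).lstar) (a b : ℝ) (_ : 0 ≤ a) (_ : 0 ≤ b)
      (_ : ∀ (i : Fin (thetaIndex (pilotDataOfK T.D T.K)).lstar) (vQ : (thetaIndex (pilotDataOfK T.D T.K)).VQ), J < (i : ℕ) + 1 →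
        ω (i, vQ) * ((((i : ℕ) : ℝ) + 1) ^ 2 - 1) ≤ a * (((i : ℕ) : ℝ) + 1) + b)
      (μ₀ A : ℝ), OffSigmaTolerance (1 - μ₀) A T (weightedTrivialMass (settingPrVolSharp (pilotDataOfK T.D T.K) (logvAnalytic_analyticLogv (F := T.K)) M archPk archSub Ψ act Mmod region n lat
            sig split qData (exists_realising_qIdeles_pilotDataOfK T.D).choose (exists_realising_thetaIdeles_pilotDataOfK T.D).choose
            (exists_realising_qIdeles_pilotDataOfK T.D).choose_spec.1 (exists_realising_qIdeles_pilotDataOfK T.D).choose_spec.2.1) ω) →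
      μ₀ * T.gap ≤
        ((J : ℝ) * (J - 1) * (2 * J + 5) / 6 + a * (((pilotDataOfK T.D T.K).lstar : ℝ) * ((pilotDataOfK T.D T.K).lstar + 1) / 2) +
              b * (pilotDataOfK T.D T.K).lstar) /
            (((pilotDataOfK T.D T.K).lstar : ℝ) * ((pilotDataOfK T.D T.K).lstar - 1) * (2 * (pilotDataOfK T.D T.K).lstar + 5) / 6) * T.gap + A := by
  intro M _ _ archPk archSub Ψ act Mmod region n HT LogLink IsFull lat Frd IsoF Ob realify Strip IsoS Mv _ sig split ObΔ N _ qData ω hω1 J hJ a b ha hb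
    hlin μ₀ A hMU
  letI := T.instFieldF; letI := T.instNumberFieldF; letI := T.instAlgebraF; letI := T.instFieldK; letI := T.instNumberFieldK
  letI := T.instAlgebraK; letI := T.instFieldFbar; letI := T.instAlgebraFbar; letI := T.instAlgebraKFbar; letI := T.instIsElliptic
  have H := bridgeHyps_settingPrVolSharp_of_ideles (pilotDataOfK T.D T.K) (logvAnalytic_analyticLogv (F := T.K)) M archPk archSub Ψ act
    Mmod region n lat sig split qData (exists_realising_thetaIdeles_pilotDataOfK T.D).choose (exists_realising_qIdeles_pilotDataOfK T.D).choose
    (exists_realising_thetaIdeles_pilotDataOfK T.D).choose_spec.1 (exists_realising_thetaIdeles_pilotDataOfK T.D).choose_spec.2.1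
    (exists_realising_qIdeles_pilotDataOfK T.D).choose_spec.1 (exists_realising_qIdeles_pilotDataOfK T.D).choose_spec.2.1
  have hg := totalTrivialMass_chosen_eq_gap T M archPk archSub Ψ act Mmod region n lat sig split qData
  have hkept := weightedTrivialMass_compl_settingPrVolSharp_le_frac_of_linearCredit (pilotDataOfK T.D T.K) (logvAnalytic_analyticLogv (F := T.K))
    M archPk archSub Ψ act Mmod region n lat sig split qData (exists_realising_qIdeles_pilotDataOfK T.D).choose
    (exists_realising_thetaIdeles_pilotDataOfK T.D).choose (exists_realising_qIdeles_pilotDataOfK T.D).choose_spec.1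
    (exists_realising_qIdeles_pilotDataOfK T.D).choose_spec.2.1 (exists_realising_thetaIdeles_pilotDataOfK T.D).choose_spec.1
    (exists_realising_thetaIdeles_pilotDataOfK T.D).choose_spec.2.2 (exists_realising_qIdeles_pilotDataOfK T.D).choose_spec.2.2 ω hω1 hJ ha hb hlin
  have hsplit := weightedTrivialMass_eq_totalTrivialMass_sub H ω
  rw [hg] at hkept hsplit
  unfold OffSigmaTolerance at hMU
  rw [hsplit] at hMU
  linarith

/-- **S1 (b) NECESSITY AT THE DATUM.** For `ω ≤ 1` with a uniform `θ·j²` credit law above the slice `J ≤ l⋇`, the weighted [MU-C]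
`OffSigmaTolerance (1−μ₀) A T (weightedTrivialMass … ω)` FORCES **`μ₀·T.gap ≤ ((S(J) + θ·(S(l⋇) − S(J)))/S(l⋇))·T.gap + A`** — «exponent `≈ 1/(f³ + θ(1 − f³))`
up to `Tol/T.gap`»; `θ = 1` is the licence itself (door N12). [claim: Mochizuki2012, status: disputed] -/
theorem mu_mul_gap_le_of_offSigmaTolerance_weightedTrivialMass_quadraticCredit_chosen {P : NFPoint} {l : ℕ} (T : Cor22.ThetaVolumeDatumAt P l) :
    letI := T.instFieldF; letI := T.instNumberFieldF; letI := T.instAlgebraF; letI := T.instFieldK; letI := T.instNumberFieldK; letI := T.instAlgebraK;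
        letI := T.instFieldFbar; letI := T.instAlgebraFbar; letI := T.instAlgebraKFbar; letI := T.instIsElliptic;
    ∀ (M : Type) [Field M] [NumberField M]
      (archPk : ∀ (j : (thetaIndex (pilotDataOfK T.D T.K)).Label) (vQ : (thetaIndex (pilotDataOfK T.D T.K)).VQ), Set ((logShellsDH (pilotDataOfK T.D T.K) (analyticLogv T.K)).Packet j vQ))
      (archSub : ∀ (j : (thetaIndex (pilotDataOfK T.D T.K)).Label) (v : (thetaIndex (pilotDataOfK T.D T.K)).V),
        Set ((logShellsDH (pilotDataOfK T.D T.K) (analyticLogv T.K)).Packet j ((thetaIndex (pilotDataOfK T.D T.K)).over v)))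
      (Ψ : ℤ → ∀ v : (thetaIndex (pilotDataOfK T.D T.K)).V, v ∈ (thetaIndex (pilotDataOfK T.D T.K)).Vbad → Set ((logShellsDH (pilotDataOfK T.D T.K) (analyticLogv T.K)).StarPacket v))
      (act : ℤ → ∀ v : (thetaIndex (pilotDataOfK T.D T.K)).V, v ∈ (thetaIndex (pilotDataOfK T.D T.K)).Vbad →
        (logShellsDH (pilotDataOfK T.D T.K) (analyticLogv T.K)).StarPacket v → Module.End ℚ ((logShellsDH (pilotDataOfK T.D T.K) (analyticLogv T.K)).StarPacket v))
      (Mmod : ℤ → ∀ j : (thetaIndex (pilotDataOfK T.D T.K)).LabelStar, Set ((logShellsDH (pilotDataOfK T.D T.K) (analyticLogv T.K)).GlobalPacket j.1))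
      (region : ℤ → ∀ j : (thetaIndex (pilotDataOfK T.D T.K)).LabelStar, FinDivisor M →
        ∀ vQ : (thetaIndex (pilotDataOfK T.D T.K)).VQ, Set ((logShellsDH (pilotDataOfK T.D T.K) (analyticLogv T.K)).Packet j.1 vQ))
      (n : ℤ) {HT : Type} {LogLink : HT → HT → Type} {IsFull : ∀ {s t : HT}, LogLink s t → Prop} (lat : LGPGaussianLogThetaLattice LogLink IsFull)
      {Frd : Type} {IsoF : Frd → Frd → Type} {Ob : Frd → Type} {realify : Frd → Frd} {Strip : Type} {IsoS : Strip → Strip → Type}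
      {Mv : ∀ v : (thetaIndex (pilotDataOfK T.D T.K)).V, v ∈ (thetaIndex (pilotDataOfK T.D T.K)).Vbad → Type} [∀ v h, Monoid (Mv v h)]
      (sig : GlobalLGPFrobenioidSignature (thetaIndex (pilotDataOfK T.D T.K)).lstar (thetaIndex (pilotDataOfK T.D T.K)).V
        (· ∈ (thetaIndex (pilotDataOfK T.D T.K)).Vbad) Frd IsoF Ob realify Strip IsoS Mv)
      (split : SplittingMonoids Mv) {ObΔ : Type} {N : ∀ v : (thetaIndex (pilotDataOfK T.D T.K)).V, v ∈ (thetaIndex (pilotDataOfK T.D T.K)).Vbad → Type}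
      [∀ v h, Monoid (N v h)] (qData : QPilotData ObΔ N)
      (ω : Fin (thetaIndex (pilotDataOfK T.D T.K)).lstar × (thetaIndex (pilotDataOfK T.D T.K)).VQ → ℝ) (_ : ∀ c, ω c ≤ 1)
      (J : ℕ) (_ : J ≤ (pilotDataOfK T.D T.K).lstar) (θ : ℝ)
      (_ : ∀ (i : Fin (thetaIndex (pilotDataOfK T.D T.K)).lstar) (vQ : (thetaIndex (pilotDataOfK T.D T.K)).VQ), J < (i : ℕ) + 1 →
        ω (i, vQ) * ((((i : ℕ) : ℝ) + 1) ^ 2 - 1) ≤ θ * ((((i : ℕ) : ℝ) + 1) ^ 2 - 1))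
      (μ₀ A : ℝ), OffSigmaTolerance (1 - μ₀) A T (weightedTrivialMass (settingPrVolSharp (pilotDataOfK T.D T.K) (logvAnalytic_analyticLogv (F := T.K)) M archPk archSub Ψ act Mmod region n lat
            sig split qData (exists_realising_qIdeles_pilotDataOfK T.D).choose (exists_realising_thetaIdeles_pilotDataOfK T.D).choose
            (exists_realising_qIdeles_pilotDataOfK T.D).choose_spec.1 (exists_realising_qIdeles_pilotDataOfK T.D).choose_spec.2.1) ω) →
      μ₀ * T.gap ≤
        ((J : ℝ) * (J - 1) * (2 * J + 5) / 6 +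
              θ * ((((pilotDataOfK T.D T.K).lstar : ℝ) * ((pilotDataOfK T.D T.K).lstar - 1) * (2 * (pilotDataOfK T.D T.K).lstar + 5) / 6) -
                (J : ℝ) * (J - 1) * (2 * J + 5) / 6)) /
            (((pilotDataOfK T.D T.K).lstar : ℝ) * ((pilotDataOfK T.D T.K).lstar - 1) * (2 * (pilotDataOfK T.D T.K).lstar + 5) / 6) * T.gap + A := by
  intro M _ _ archPk archSub Ψ act Mmod region n HT LogLink IsFull lat Frd IsoF Ob realify Strip IsoS Mv _ sig split ObΔ N _ qData ω hω1 J hJ θ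
    hquad μ₀ A hMU
  letI := T.instFieldF; letI := T.instNumberFieldF; letI := T.instAlgebraF; letI := T.instFieldK; letI := T.instNumberFieldK
  letI := T.instAlgebraK; letI := T.instFieldFbar; letI := T.instAlgebraFbar; letI := T.instAlgebraKFbar; letI := T.instIsElliptic
  have H := bridgeHyps_settingPrVolSharp_of_ideles (pilotDataOfK T.D T.K) (logvAnalytic_analyticLogv (F := T.K)) M archPk archSub Ψ act
    Mmod region n lat sig split qData (exists_realising_thetaIdeles_pilotDataOfK T.D).choose (exists_realising_qIdeles_pilotDataOfK T.D).choose
    (exists_realising_thetaIdeles_pilotDataOfK T.D).choose_spec.1 (exists_realising_thetaIdeles_pilotDataOfK T.D).choose_spec.2.1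
    (exists_realising_qIdeles_pilotDataOfK T.D).choose_spec.1 (exists_realising_qIdeles_pilotDataOfK T.D).choose_spec.2.1
  have hg := totalTrivialMass_chosen_eq_gap T M archPk archSub Ψ act Mmod region n lat sig split qData
  have hkept := weightedTrivialMass_compl_settingPrVolSharp_le_frac_of_quadraticCredit (pilotDataOfK T.D T.K) (logvAnalytic_analyticLogv (F := T.K))
    M archPk archSub Ψ act Mmod region n lat sig split qData (exists_realising_qIdeles_pilotDataOfK T.D).choose
    (exists_realising_thetaIdeles_pilotDataOfK T.D).choose (exists_realising_qIdeles_pilotDataOfK T.D).choose_spec.1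
    (exists_realising_qIdeles_pilotDataOfK T.D).choose_spec.2.1 (exists_realising_thetaIdeles_pilotDataOfK T.D).choose_spec.1
    (exists_realising_thetaIdeles_pilotDataOfK T.D).choose_spec.2.2 (exists_realising_qIdeles_pilotDataOfK T.D).choose_spec.2.2 ω hω1 hJ hquad
  have hsplit := weightedTrivialMass_eq_totalTrivialMass_sub H ω
  rw [hg] at hkept hsplit
  unfold OffSigmaTolerance at hMU
  rw [hsplit] at hMU
  linarith

end Datum

end Summit.ABC.IUTFork.Repair.RH.CellWeights

end
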